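import Summits.CriticalPhenomena.Ising3DConformalLimit.Theorems.FKParityRobustnessIndependentStrandsJoinEventuallyUpgrade
import Summits.CriticalPhenomena.Ising3DConformalLimit.Theorems.FKParityRobustnessIndependentStrandsJoinNonGaussianResidual
import Summits.CriticalPhenomena.Ising3DConformalLimit.Theorems.FKParityRobustnessSourceTrailsMeetStrands
import Summits.CriticalPhenomena.Ising3DConformalLimit.Theorems.FKParityRobustnessIndependentStrandsJoinR1SecondMomentCurrents
import Literature.Probability.LatticeModels.IsingExponents
import HarnessLib

/-!
# Strategy census s9 — typed signatures for crux `IndependentStrandsJoin` (item stmt-CriticalPhenomena-14625)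

Scratch file of the independent strategist seat `cstrat-…-s9` (family `s`).  Every statement named in
`STRATEGY-CENSUS-s9.md` is typed here over existing declarations; the small logical relations between them
(which is weaker / stronger than the crux, which closes the ROUTE rather than the crux) are kernel-checked.
Nothing here is a registered line: the census verdict is `no-strategy-short-of-summit`, and this file is the
evidence that each switch was actually typed and followed to the point where it loses leverage.

Sections: §1 weaker intermediates (W0–W2) · §2 decomposition attempt (FatFat ∧ SourcelessInsensitivity) ·
§3 strengthenings (S⁺) · §4 transfer target · §5 negation.
-/

noncomputable section

open Filter Topology Finset MeasureTheory
open Literature.Probability.LatticeModels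
open Summit.CriticalPhenomena.Ising3DConformalLimit.Theses.FKParityRobustness
open Summit.CriticalPhenomena.Ising3DConformalLimit.Cruxes.ParityRobustMerging.PlaquetteXorSurgery (tetra tetra_inj)
open Summit.CriticalPhenomena.Ising3DConformalLimit.Cruxes.IndependentStrandsJoin.PinchToTetra
open Summit.CriticalPhenomena.Ising3DConformalLimit.FKParityRobustnessFarMergingGivesU4 (farMergingGivesU4_proof)

namespace Summit.CriticalPhenomena.Ising3DConformalLimit.Cruxes.IndependentStrandsJoin.StrategyS9

open scoped Classical ENNReal

/-! ## §1  Weaker intermediates, read off the summit `Ising3DConformalLimit = MoebiusLimit-part ∧ (iii)` -/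

/-- **W0 = clause (iii) itself** (`NonGaussianLimit`, item 0636) closes the ROUTE with the imported complement and
WITHOUT the crux — so W0 is the weakest honest intermediate; it is the sub-problem's own third clause (costume as a
crux: no lattice content, nothing to attack that the summit does not already ask). -/
theorem route_of_w0 (hM : MoebiusLimit) (h0 : NonGaussianLimit) : _root_.Ising3DConformalLimit :=
  ising3DConformalLimit_of_moebius_nonGaussian hM h0

/-- crux ⟹ W0 (landed bridge `JoinForcesU4`). -/
theorem w0_of_crux (h : IndependentStrandsJoin) : NonGaussianLimit :=
  nonGaussianLimit_of_independentStrandsJoin h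

/-- **W1 = far merging at the tetrahedron along infinitely many scales** (`TetraMergingIO`): crux ⟹ W1 … -/
theorem w1_of_crux (h : IndependentStrandsJoin) : TetraMergingIO := by
  obtain ⟨c, hc, l₁, hl⟩ := independentStrandsJoin_iff_tetraMergingEventually.1 h
  exact ⟨c, hc, fun L₀ => ⟨max L₀ l₁, le_max_left _ _, hl _ (le_max_right _ _)⟩⟩

/-- … and W1 ⟹ crux back as soon as the pointwise limit exists (`LimitExists` ⊂ `MoebiusLimit`): the subsequence
slack is void on the route (landed `tetraMergingEventually_of_io`). -/
theorem crux_of_w1 (hL : LimitExists) (h : TetraMergingIO) : IndependentStrandsJoin :=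
  independentStrandsJoin_iff_tetraMergingEventually.2 (tetraMergingEventually_of_io hL h)

/-- `MoebiusLimit ⟹ LimitExists` (drop `Δ` and covariance). -/
theorem limitExists_of_moebius (hM : MoebiusLimit) : LimitExists := by
  obtain ⟨ρ, Δ, S, hρ, _, hlim, hnd, _⟩ := hM
  exact ⟨ρ, S, hρ, hlim, hnd⟩

/-- **W2 = far merging i.o. at SOME injective lattice shape** (the antecedent of the landed `FarMergingGivesU4`). -/
def FarMergingSomewhereIO : Prop :=
  ∃ c : ℝ, 0 < c ∧ ∃ x : Fin 4 → Site 3, Function.Injective x ∧ ∀ L₀ : ℕ, ∃ L : ℕ, L₀ ≤ L ∧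
    criticalCorr 3 4 (fun i => (L : ℤ) • x i) -
        (criticalCorr 3 2 ![(L : ℤ) • x 0, (L : ℤ) • x 1] * criticalCorr 3 2 ![(L : ℤ) • x 2, (L : ℤ) • x 3] +
          criticalCorr 3 2 ![(L : ℤ) • x 0, (L : ℤ) • x 2] * criticalCorr 3 2 ![(L : ℤ) • x 1, (L : ℤ) • x 3] +
          criticalCorr 3 2 ![(L : ℤ) • x 0, (L : ℤ) • x 3] * criticalCorr 3 2 ![(L : ℤ) • x 1, (L : ℤ) • x 2]) ≤
      -(c * (criticalCorr 3 2 ![(L : ℤ) • x 0, (L : ℤ) • x 1] * criticalCorr 3 2 ![(L : ℤ) • x 2, (L : ℤ) • x 3]))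

/-- W1 ⟹ W2 (take `x = tetra`). -/
theorem w2_of_w1 (h : TetraMergingIO) : FarMergingSomewhereIO := by
  obtain ⟨c, hc, hio⟩ := h
  exact ⟨c, hc, tetra, tetra_inj, fun L₀ => by
    obtain ⟨l, hl, hb⟩ := hio L₀
    exact ⟨l, hl, by simpa only [U4crit, GGcrit] using hb⟩⟩

/-- W2 ⟹ W0, hence W2 closes the ROUTE given `MoebiusLimit` (landed `farMergingGivesU4_proof`).  W2 is genuinely
weaker than the crux as a lattice statement (any shape, any subsequence) but NOT easier: by Aizenman's identity
`U₄(Lx) = −2·τ(Lx₀,Lx₁)τ(Lx₂,Lx₃)·P^{01}⊗P^{23}[Lx₀ ↔ Lx₂ in n₁+n₂]` (an EQUALITY, `ursellFour_eq_doubleCurrent_holds`)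
every shape's far-merging floor is the same two-replica sourced double-current intersection floor. -/
theorem route_of_w2 (hM : MoebiusLimit) (h : FarMergingSomewhereIO) : _root_.Ising3DConformalLimit :=
  ising3DConformalLimit_of_moebius_nonGaussian hM (farMergingGivesU4_proof h)

/-! ## §2  Decomposition attempt in random-current dress (the only split whose seam is not trivially the crux)

`G_N` = nearest-neighbour graph of the free box `Λ_N`, `β = β_c(3)`, `a = l·tetra`.  -/

/-- The crux in Aizenman's dress: `P^{a₀a₁}_N ⊗ P^{a₂a₃}_N [a₀ ↔ a₂ in n̂₁+n̂₂] ≥ c` uniformly in `l` (N large).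
(Equivalent to the crux up to the constants 2,3 of Disproof §B / `independentStrandsJoin_iff_forall_R4ratio`
after the box → ℤ³ passage; typed here only to state the split.) -/
def CruxCurrents : Prop :=
  ∃ c : ℝ, 0 < c ∧ ∀ l : ℕ, 1 ≤ l → ∃ N₀ : ℕ, ∀ N : ℕ, N₀ ≤ N → ∀ a : Fin 4 → ↥(box 3 N),
    (∀ i, ((a i : Site 3)) = (l : ℤ) • tetra i) →
    ENNReal.ofReal c ≤
      doubleCurrentMeasure ((zdGraph 3).comap (Subtype.val : ↥(box 3 N) → Site 3)) (criticalBeta 3)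
        {a 0, a 1} {a 2, a 3}
        (tracedConn ((zdGraph 3).comap (Subtype.val : ↥(box 3 N) → Site 3)) (a 0) (a 2))

/-- **Piece 1 `FatFatIntersect`** — the two FULL double-current clusters meet: with `(n₁,n₃) ~ P^{a₀a₁} ⊗ P^∅` and
`(n₂,n₄) ~ P^{a₂a₃} ⊗ P^∅` independent, `P[C_{n₁+n₃}(a₀) ∩ C_{n₂+n₄}(a₂) ≠ ∅] ≥ c`.  Both one- and two-point
cluster densities of a sourced+sourceless double current are switching quantities (`= τ(a₀z)τ(za₁)/τ(a₀a₁)`,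
tree bound), so Paley–Zygmund closes this piece AT EXPONENT LEVEL (`E N ≍ l^{1−2η} → ∞`); as typed (constants) it is
provable only modulo two-point regularity `TwoPointRegularity` below — unconditionally the envelope
`c‖x‖⁻² ≤ τ_{β_c}(x) ≤ C‖x‖⁻¹` (tree: `StubTreeFloor`) leaves a polynomial loss. -/
def FatFatIntersect : Prop :=
  ∃ c : ℝ, 0 < c ∧ ∀ l : ℕ, 1 ≤ l → ∃ N₀ : ℕ, ∀ N : ℕ, N₀ ≤ N → ∀ a : Fin 4 → ↥(box 3 N),
    (∀ i, ((a i : Site 3)) = (l : ℤ) • tetra i) →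
    ENNReal.ofReal c ≤
      ((doubleCurrentMeasure ((zdGraph 3).comap (Subtype.val : ↥(box 3 N) → Site 3)) (criticalBeta 3) {a 0, a 1} ∅).prod
        (doubleCurrentMeasure ((zdGraph 3).comap (Subtype.val : ↥(box 3 N) → Site 3)) (criticalBeta 3) {a 2, a 3} ∅))
        {q | ((q.1.1 + q.1.2).cluster (a 0) ∩ (q.2.1 + q.2.2).cluster (a 2)).Nonempty}

/-- **Piece 2 `SourcelessInsensitivity`** — removing the two sourceless currents costs at most a constant factor:
`P^{01}⊗P^{23}[a₀ ↔ a₂ in n̂₁+n̂₂] ≥ κ · P[fat clusters meet]`.  This is exactly Duminil-Copin's "impact of the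
additional loops" (ICM22 p.20), implied by the crux (the right side is ≤ 1), and carries the whole difficulty:
the seam `cruxCurrents_of` below is three lines.  Verdict in the census: NOT an honest split (piece 2 ≡ crux in
content; piece 1 is conditional on two-point regularity). -/
def SourcelessInsensitivity : Prop :=
  ∃ κ : ℝ, 0 < κ ∧ ∀ l : ℕ, 1 ≤ l → ∃ N₀ : ℕ, ∀ N : ℕ, N₀ ≤ N → ∀ a : Fin 4 → ↥(box 3 N),
    (∀ i, ((a i : Site 3)) = (l : ℤ) • tetra i) →
    ENNReal.ofReal κ *
        ((doubleCurrentMeasure ((zdGraph 3).comap (Subtype.val : ↥(box 3 N) → Site 3)) (criticalBeta 3) {a 0, a 1} ∅).prod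
          (doubleCurrentMeasure ((zdGraph 3).comap (Subtype.val : ↥(box 3 N) → Site 3)) (criticalBeta 3) {a 2, a 3} ∅))
          {q | ((q.1.1 + q.1.2).cluster (a 0) ∩ (q.2.1 + q.2.2).cluster (a 2)).Nonempty} ≤
      doubleCurrentMeasure ((zdGraph 3).comap (Subtype.val : ↥(box 3 N) → Site 3)) (criticalBeta 3)
        {a 0, a 1} {a 2, a 3}
        (tracedConn ((zdGraph 3).comap (Subtype.val : ↥(box 3 N) → Site 3)) (a 0) (a 2))

/-- The seam of the split is trivial (which is allowed) — but it shows where the content sits: in piece 2. -/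
theorem cruxCurrents_of (hF : FatFatIntersect) (hS : SourcelessInsensitivity) : CruxCurrents := by
  obtain ⟨c, hc, hF⟩ := hF
  obtain ⟨κ, hκ, hS⟩ := hS
  refine ⟨κ * c, mul_pos hκ hc, fun l hl => ?_⟩
  obtain ⟨N₁, h₁⟩ := hF l hl
  obtain ⟨N₂, h₂⟩ := hS l hl
  refine ⟨max N₁ N₂, fun N hN a ha => ?_⟩
  have e₁ := h₁ N (le_trans (le_max_left _ _) hN) a ha
  have e₂ := h₂ N (le_trans (le_max_right _ _) hN) a ha
  calc ENNReal.ofReal (κ * c) = ENNReal.ofReal κ * ENNReal.ofReal c := ENNReal.ofReal_mul hκ.le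
    _ ≤ ENNReal.ofReal κ * _ := by gcongr
    _ ≤ _ := e₂

/-- The two-point regularity input under which piece 1 is provable by the landed second-moment machinery
(`stub_treeFloor_of_etaBounds`, `stub_bubble_of_etaBounds`): `τ_{β_c}(x) ≍ ‖x‖^{-(1+η)}` with `η < 1/2`.
OPEN on ℤ³ (only `0 ≤ η ≤ 1` window and `η ≤ 1/2` IF η exists, Duminil-Copin–Panis 2024 Thm 1.5). -/
def TwoPointRegularity : Prop :=
  ∃ η : ℝ, η < 1 / 2 ∧ HasIsingEtaBounds 3 η

/-! ## §3  Strengthenings S⁺ -/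

/-- S⁺₁ = `SourceTrailsMeet` (item 11255): landed `SourceTrailsMeet → crux`; but `SourceTrailsMeet ↔ PRM ∧ FK4C`
(`sourceTrailsMeet_iff_parityRobustMerging_and_fkFourConnectivity`) and PRM is predicted false (x₄ ≈ 3.25 > 3). -/
theorem crux_of_sPlus1 (h : SourceTrailsMeet) : IndependentStrandsJoin :=
  Summit.CriticalPhenomena.Ising3DConformalLimit.Theorems.independentStrandsJoin_of_sourceTrailsMeet h

/-- S⁺₂ = far merging EVENTUALLY AT EVERY injective shape with a shape-dependent constant ("lattice hyperscaling at
all shapes").  Stronger than the crux (take `x = tetra`); no added rigidity: no shape-to-shape monotonicity or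
induction on shapes is available (each shape is the same two-replica intersection floor, §1 W2). -/
def AllShapesMergingEventually : Prop :=
  ∀ x : Fin 4 → Site 3, Function.Injective x → ∃ c : ℝ, 0 < c ∧ ∃ L₁ : ℕ, ∀ L : ℕ, L₁ ≤ L →
    criticalCorr 3 4 (fun i => (L : ℤ) • x i) -
        (criticalCorr 3 2 ![(L : ℤ) • x 0, (L : ℤ) • x 1] * criticalCorr 3 2 ![(L : ℤ) • x 2, (L : ℤ) • x 3] +
          criticalCorr 3 2 ![(L : ℤ) • x 0, (L : ℤ) • x 2] * criticalCorr 3 2 ![(L : ℤ) • x 1, (L : ℤ) • x 3] +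
          criticalCorr 3 2 ![(L : ℤ) • x 0, (L : ℤ) • x 3] * criticalCorr 3 2 ![(L : ℤ) • x 1, (L : ℤ) • x 2]) ≤
      -(c * (criticalCorr 3 2 ![(L : ℤ) • x 0, (L : ℤ) • x 1] * criticalCorr 3 2 ![(L : ℤ) • x 2, (L : ℤ) • x 3]))

theorem crux_of_sPlus2 (h : AllShapesMergingEventually) : IndependentStrandsJoin := by
  obtain ⟨c, hc, L₁, hL⟩ := h tetra tetra_inj
  exact independentStrandsJoin_iff_tetraMergingEventually.2
    ⟨c, hc, L₁, fun l hl => by simpa only [U4crit, GGcrit] using hL l hl⟩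

/-- S⁺₃ = `RectDominance` (the live lead line r7 `pinch-to-tetra`, its ONE stub; landed
`independentStrandsJoin_of_rectDominance`): `⟨σσσσ⟩(l·rect) ≤ (3 − c)·GGcrit l`.  GFF-false floor
(GFF_{1/2}: 3.708; bootstrap 2.728; MC ≤ 2.904(4)) — needs an Ising-specific input; not duplicated here. -/
theorem crux_of_sPlus3
    (h : ∃ c : ℝ, 0 < c ∧ ∃ l₁ : ℕ, ∀ l : ℕ, l₁ ≤ l →
      criticalCorr 3 4 (fun i => (l : ℤ) •
          (![![-1, -1, -1], ![1, 1, -1], ![-1, -1, 1], ![1, 1, 1]] : Fin 4 → Site 3) i) ≤ (3 - c) * GGcrit l) :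
    IndependentStrandsJoin :=
  independentStrandsJoin_of_rectDominance h

/-- S⁺₄ = sourceless union connects (`ℓ^∅ ⊗ ℓ^∅ [a₀ ↔ a₂ in L₁ ∪ L₂] ≥ c`), the naive "union percolates"
strengthening, typed in the crux's own loop language.  PROVABLY FALSE: under the loop/current coupling
`L ⊆ trace n`, so the left side is `≤ P^∅⊗P^∅[a₀ ↔ a₂ in n₁+n₂] = ⟨σ_{a₀}σ_{a₂}⟩² → 0` (switching lemma +
infrared bound).  Recorded as the refutable end of the strengthening axis. -/
def SourcelessUnionConnects : Prop :=
  ∃ c : ℝ, 0 < c ∧ ∀ l : ℕ, 1 ≤ l → ∃ N₀ : ℕ, ∀ N : ℕ, N₀ ≤ N → ∀ a : Fin 4 → ↥(box 3 N),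
    (∀ i, ((a i : Site 3)) = (l : ℤ) • tetra i) →
    c * loopO1PartitionFunction ((zdGraph 3).comap (Subtype.val : ↥(box 3 N) → Site 3))
        (Real.tanh (criticalBeta 3)) ∅ ^ 2 ≤
    ∑ F₁ ∈ tJoins ((zdGraph 3).comap (Subtype.val : ↥(box 3 N) → Site 3)) Set.univ ∅,
      ∑ F₂ ∈ tJoins ((zdGraph 3).comap (Subtype.val : ↥(box 3 N) → Site 3)) Set.univ ∅,
        if (SimpleGraph.fromEdgeSet ((↑F₁ : Set (Sym2 ↥(box 3 N))) ∪ ↑F₂)).Reachable (a 0) (a 2)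
        then Real.tanh (criticalBeta 3) ^ (F₁.card + F₂.card) else 0

/-! ## §4  Transfer target (what the d = 2 / ADTW-2019 argument would have to produce in d = 3)

The planar sibling (Aizenman 1982; Aizenman–Duminil-Copin–Tassion–Warzel 2019 "emergent planarity") proves the
intersection floor from: (T1) the two sourced traces' planar PROJECTIONS cross deterministically; (T2) each
crossing forces `≥ c log l` near-encounters at geometrically separated scales; (T3) each near-encounter links with
conditional probability `≥ κ`.  In d = 3 two space curves generically do not meet, (T1) is void, and the
near-encounter COUNT floor (typed below as a mean-overlap floor for the two sourced double currents restricted to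
the traced clusters) is itself the hyperscaling statement — the first non-transferring step. -/
def NearEncounterFloor : Prop :=
  ∃ c : ℝ, 0 < c ∧ ∀ l : ℕ, 1 ≤ l → ∃ N₀ : ℕ, ∀ N : ℕ, N₀ ≤ N → ∀ a : Fin 4 → ↥(box 3 N),
    (∀ i, ((a i : Site 3)) = (l : ℤ) • tetra i) →
    ENNReal.ofReal c ≤
      ∑ z : ↥(box 3 N),
        doubleCurrentMeasure ((zdGraph 3).comap (Subtype.val : ↥(box 3 N) → Site 3)) (criticalBeta 3)
          {a 0, a 1} {a 2, a 3} {q | z ∈ q.1.cluster (a 0) ∧ z ∈ q.2.cluster (a 2)}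

/-! ## §5  Negation -/

/-- `¬ crux ⟺` tetrahedral Gaussianity along a subsequence of scales: `∀ ε > 0, ∀ l₁, ∃ l ≥ l₁, R₄(A_l) < ε`
(a triviality statement for 3D Ising at its most non-Gaussian configuration; bootstrap `R₄ → 0.951`). -/
theorem not_crux_iff :
    ¬ IndependentStrandsJoin ↔ ∀ ε : ℝ, 0 < ε → ∀ l₁ : ℕ, ∃ l : ℕ, l₁ ≤ l ∧ R4ratio l < ε := by
  rw [independentStrandsJoin_iff_R4ratio]
  push Not
  rfl

end Summit.CriticalPhenomena.Ising3DConformalLimit.Cruxes.IndependentStrandsJoin.StrategyS9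

end
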